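import Summits.CriticalPhenomena.SAWScalingLimit.Theorems.SAWDevelopingMapHexConjectureKPDichotomy
import Summits.CriticalPhenomena.SAWScalingLimit.Theorems.SAWDevelopingMapHexConjectureKPAnalytic
import Summits.CriticalPhenomena.SAWScalingLimit.Theorems.SAWDevelopingMapHexConjectureKPTransfer
import Mathlib.Data.Nat.Log
import HarnessLib

/-!
# Crux `HexConjecture` (stmt-CriticalPhenomena-0808), line `root-locality-replaces-loewner`:
the window two-point lower bound from the lower regularity of the triangle tail (registered stub
`stub_windowTwoPointLowerBound_of_reg`)

Landing target:
`Summits/CriticalPhenomena/SAWScalingLimit/Theorems/SAWDevelopingMapHexConjectureWindowTwoPointOfReg.lean`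
(`--supports stmt-CriticalPhenomena-0808`; lead prover-line-stmt-CriticalPhenomena-0808-c9-0).

The line's lever after seat c8 is the WINDOW TWO-POINT LOWER BOUND (skeleton statement 2♮♮, `WTLB`):
for some `0 < θa < θb ≤ 1/4`, one constant and all large `R`, the Glazman–Manolescu triangle tail
`triDl ⌊R/4⌋` is dominated LINEARLY by the boundary two-point mass of the critical hexagonal-lattice SAW in
the upper half-box of radius `R`, summed over the reference window of floor offsets `[θa R, θb R]`.  This file
reduces it to ONE regularity statement about ONE explicit non-increasing sequence:

  `REG`: `∃ C, ∀ T ≥ 1, Σ_{i ≤ T} triDl i ≤ C·(T+1)·triDl T`  (lower regularity of the triangle tail —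
  the partial sums are comparable to `T` times the last term; true for every regularly varying sequence of
  index `> -1`, conjecturally `triDl T ≍ T^(-1/4)`),

by Krachun–Panagiotis's renewal construction in CONFINED form: the dichotomy of constructions (a)/(b)
(`stub_kp_dichotomy`, Lemmas 3.2–3.3) and the analytic step (`stub_kp_analytic`: under `REG` the caps
satisfy `(1 + M_k)·triDl k ≤ C'·k·triDl(k/2)·triDl(k/4)` by Lemma 3.1 and the ratios `triDl(aT)/triDl(bT)`,
`a < b ≤ 36a`, are bounded, so either alternative gives `c·triDl(9T) ≤ W(T)` for every `T`), transferred from the strip `S_{32T+1,32T+1}` and the window `[T, 21T]`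
to the half-box of radius `R = Θ(T)` and the window `[R/168, R/4]` (`stub_kp_transfer`).  Together with
the cube version (`triDl_cube_le_windowMass`, unconditional) and the upper companion
(`farOffsetMass_le_sub_triA`), this is the state of the lever: `WTLB ⟸ REG`.
-/

noncomputable section

open scoped Classical
open Finset
open Literature.Probability.RandomPlanarGeometry.SAW Literature.Probability.RandomPlanarGeometry.SAW.HV

namespace Summit.CriticalPhenomena.SAWScalingLimit.Theorems.HexConjecture.RootLocality

/-- `cos(π/8)/(16cos(π/4)) > 0`. [folklore] -/
theorem wtlbOfReg_ca_pos : 0 < Real.cos (Real.pi / 8) / (16 * Real.cos (Real.pi / 4)) :=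
  div_pos cos_pi_div_eight_pos (mul_pos (by norm_num) cos_pi_div_four_pos')

/-- **The confined linear lower bound under `REG`**: `∃ c > 0, ∀ T ≥ 1, c·triDl(9T) ≤ W(T)`, `W(T)` the coded
floor-arch mass of `S_{32T+1,32T+1}` over the window `[T, 21T]` (Krachun–Panagiotis Cor. 3.1 made linear
by the regularity hypothesis). [cite: KrachunPanagiotis2026, Corollary 3.1 and Lemmas 3.1–3.3] -/
theorem codedWindow_linear_of_reg
    (hreg : ∃ C : ℝ, ∀ T : ℕ, 1 ≤ T → ∑ i ∈ Finset.range (T + 1), triDl i ≤ C * ((T : ℝ) + 1) * triDl T) :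
    ∃ c : ℝ, 0 < c ∧ ∀ T : ℕ, 1 ≤ T → c * triDl (9 * T) ≤ ∑ d ∈ Finset.Icc (T : ℤ) (21 * T), ∑ P ∈ (midWalks (stripV (32 * T + 1) (32 * T + 1))).filter (fun P => finalDart P = ((d, 0, false), (d, -1, true)) ∨ finalDart P = ((d, -1, true), (d, 0, false))), hexCriticalFugacity ^ mwLen P :=
  stub_kp_analytic hreg _ _ wtlbOfReg_ca_pos (by norm_num) (fun T => ∑ d ∈ Finset.Icc (T : ℤ) (21 * T), ∑ P ∈ (midWalks (stripV (32 * T + 1) (32 * T + 1))).filter (fun P => finalDart P = ((d, 0, false), (d, -1, true)) ∨ finalDart P = ((d, -1, true), (d, 0, false))), hexCriticalFugacity ^ mwLen P)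
    (fun T hT M₁ M₂ h₁ h₂ => stub_kp_dichotomy T hT M₁ M₂ h₁ h₂)

/-- **Registered sub-goal `stub_windowTwoPointLowerBound_of_reg`** (crux item stmt-CriticalPhenomena-0808,
line `root-locality-replaces-loewner`): THE WINDOW TWO-POINT LOWER BOUND FROM THE LOWER REGULARITY OF THE
TRIANGLE TAIL — `REG → WTLB` (the skeleton's `TriDlLowerRegular → WindowTwoPointLowerBound`), with
`θa = 1/168`, `θb = 1/4`. [cite: KrachunPanagiotis2026, §3; GlazmanManolescu2019, §4.1; DuminilCopinSmirnov2012, §3] -/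
theorem stub_windowTwoPointLowerBound_of_reg : (∃ C : ℝ, ∀ T : ℕ, 1 ≤ T → ∑ i ∈ Finset.range (T + 1), Literature.Probability.RandomPlanarGeometry.SAW.HV.triDl i ≤ C * ((T : ℝ) + 1) * Literature.Probability.RandomPlanarGeometry.SAW.HV.triDl T) → ∃ θa θb C : ℝ, 0 < θa ∧ θa < θb ∧ θb ≤ 1 / 4 ∧ 0 < C ∧ ∃ R₀ : ℝ, 0 < R₀ ∧ ∀ R : ℝ, R₀ ≤ R → ∀ (x : Literature.Probability.LatticeModels.Site 2) (B : Finset Literature.Probability.LatticeModels.HexVertex) (S' : Finset ℤ), (∀ v : Literature.Probability.LatticeModels.HexVertex, v ∈ B ↔ (x 1 ≤ v.1 1 ∧ dist (Literature.Probability.LatticeModels.hexCenter v) (Literature.Probability.RandomPlanarGeometry.SAW.hexMidpoint s((x - Pi.single 1 1, 1), (x, 0))) ≤ R)) → (∀ d : ℤ, d ∈ S' ↔ (θa * R ≤ (d : ℝ) ∧ (d : ℝ) ≤ θb * R)) → Literature.Probability.RandomPlanarGeometry.SAW.HV.triDl ⌊R / 4⌋₊ ≤ C * ∑ d ∈ S',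 ∑ γ : Literature.Probability.RandomPlanarGeometry.SAW.HexMidEdgeSAW B s((x - Pi.single 1 1, 1), (x, 0)) s((x + Pi.single 0 d - Pi.single 1 1, 1), (x + Pi.single 0 d, 0)), Literature.Probability.RandomPlanarGeometry.SAW.hexCriticalFugacity ^ γ.length :=
  fun hreg => stub_kp_transfer (fun T => ∑ d ∈ Finset.Icc (T : ℤ) (21 * T), ∑ P ∈ (midWalks (stripV (32 * T + 1) (32 * T + 1))).filter (fun P => finalDart P = ((d, 0, false), (d, -1, true)) ∨ finalDart P = ((d, -1, true), (d, 0, false))), hexCriticalFugacity ^ mwLen P) (fun _ => rfl) (codedWindow_linear_of_reg hreg)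

/-! ### A handy sufficient form of `REG`: doubling regularity -/

/-- **Dyadic step**: if `a ≥ 0` is non-increasing and `q·a T ≤ a(2T)` for `T ≥ 1` with `q > 1/2`, then
`Σ_{1 ≤ i < 2^n} a i ≤ (1/(2q−1))·2^n·a(2^n)`. [folklore] -/
theorem regOfDoubling_dyadic {a : ℕ → ℝ} (h0 : ∀ n, 0 ≤ a n) (hmono : Antitone a) {q : ℝ}
    (hq : 1 / 2 < q) (hd : ∀ T : ℕ, 1 ≤ T → q * a T ≤ a (2 * T)) (n : ℕ) :
    ∑ i ∈ Ico 1 (2 ^ n), a i ≤ 1 / (2 * q - 1) * (2 : ℝ) ^ n * a (2 ^ n) := by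
  have hq0 : 0 < q := by linarith
  have h2q : 0 < 2 * q - 1 := by linarith
  set D : ℝ := 1 / (2 * q - 1) with hD
  have hD0 : 0 < D := one_div_pos.2 h2q
  have hkey : (D + 1) / q = 2 * D := by
    rw [hD]; field_simp; ring
  induction n with
  | zero =>
    rw [pow_zero, Ico_self, sum_empty, pow_zero, mul_one]
    exact mul_nonneg hD0.le (h0 1)
  | succ n ih =>
    have hle : 2 ^ n ≤ 2 ^ (n + 1) := Nat.pow_le_pow_right two_pos (Nat.le_succ n)
    have h1n : 1 ≤ 2 ^ n := Nat.one_le_two_pow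
    rw [← sum_Ico_consecutive a h1n hle]
    have hcard : 2 ^ (n + 1) - 2 ^ n = 2 ^ n := by rw [pow_succ]; omega
    have hblock : ∑ i ∈ Ico (2 ^ n) (2 ^ (n + 1)), a i ≤ (2 : ℝ) ^ n * a (2 ^ n) := by
      calc ∑ i ∈ Ico (2 ^ n) (2 ^ (n + 1)), a i ≤ ∑ _i ∈ Ico (2 ^ n) (2 ^ (n + 1)), a (2 ^ n) :=
            sum_le_sum fun i hi => hmono (mem_Ico.1 hi).1
        _ = (2 : ℝ) ^ n * a (2 ^ n) := by
            rw [sum_const, Nat.card_Ico, nsmul_eq_mul, hcard]; push_cast; ring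
    have hstep : q * a (2 ^ n) ≤ a (2 ^ (n + 1)) := by
      rw [pow_succ, mul_comm (2 ^ n) 2]; exact hd (2 ^ n) h1n
    calc ∑ i ∈ Ico 1 (2 ^ n), a i + ∑ i ∈ Ico (2 ^ n) (2 ^ (n + 1)), a i
        ≤ D * 2 ^ n * a (2 ^ n) + 2 ^ n * a (2 ^ n) := add_le_add ih hblock
      _ = (D + 1) / q * 2 ^ n * (q * a (2 ^ n)) := by field_simp
      _ ≤ (D + 1) / q * 2 ^ n * a (2 ^ (n + 1)) :=
          mul_le_mul_of_nonneg_left hstep (by positivity)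
      _ = D * 2 ^ (n + 1) * a (2 ^ (n + 1)) := by rw [hkey, pow_succ]; ring

/-- **Doubling regularity implies lower regularity**: if `a > 0` is non-increasing and `q·a T ≤ a(2T)` for all
`T ≥ 1` with some `q > 1/2`, then `Σ_{i ≤ T} a i ≤ C·(T+1)·a T` for all `T ≥ 1` (dyadic blocks; `C = 2/(2q−1) + a 0/(q·a 1)`).
[folklore] -/
theorem reg_of_doubling {a : ℕ → ℝ} (hpos : ∀ n, 0 < a n) (hmono : Antitone a) {q : ℝ}
    (hq : 1 / 2 < q) (hd : ∀ T : ℕ, 1 ≤ T → q * a T ≤ a (2 * T)) :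
    ∃ C : ℝ, ∀ T : ℕ, 1 ≤ T → ∑ i ∈ range (T + 1), a i ≤ C * ((T : ℝ) + 1) * a T := by
  have hq0 : 0 < q := by linarith
  have h2q : 0 < 2 * q - 1 := by linarith
  have ha1 := hpos 1
  have ha0 := hpos 0
  set D : ℝ := 1 / (2 * q - 1) with hD
  have hD0 : 0 < D := one_div_pos.2 h2q
  refine ⟨2 * D + a 0 / (q * a 1), fun T hT => ?_⟩
  set n := Nat.log 2 T with hn
  have hTn : T < 2 ^ (n + 1) := Nat.lt_pow_succ_log_self one_lt_two T
  have hnT : 2 ^ n ≤ T := Nat.pow_log_le_self 2 (by omega)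
  have hdy := regOfDoubling_dyadic (fun n => (hpos n).le) hmono hq hd (n + 1)
  have hsplit : ∑ i ∈ range (T + 1), a i = a 0 + ∑ i ∈ Ico 1 (T + 1), a i := by
    rw [range_eq_Ico, ← sum_Ico_consecutive a (Nat.zero_le 1) (by omega : 1 ≤ T + 1),
      Nat.Ico_succ_singleton, sum_singleton]
  have hsub : ∑ i ∈ Ico 1 (T + 1), a i ≤ ∑ i ∈ Ico 1 (2 ^ (n + 1)), a i :=
    sum_le_sum_of_subset_of_nonneg (Ico_subset_Ico le_rfl (by omega)) fun i _ _ => (hpos i).le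
  have haT : a (2 ^ (n + 1)) ≤ a T := hmono hTn.le
  have h2n : (2 : ℝ) ^ (n + 1) ≤ 2 * ((T : ℝ) + 1) := by
    have : 2 ^ (n + 1) ≤ 2 * (T + 1) := by rw [pow_succ]; omega
    exact_mod_cast this
  have hchain : ∀ m : ℕ, q ^ m * a 1 ≤ a (2 ^ m) := by
    intro m
    induction m with
    | zero => simp
    | succ m ihm =>
      calc q ^ (m + 1) * a 1 = q * (q ^ m * a 1) := by ring
        _ ≤ q * a (2 ^ m) := mul_le_mul_of_nonneg_left ihm hq0.le
        _ ≤ a (2 * 2 ^ m) := hd _ Nat.one_le_two_pow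
        _ = a (2 ^ (m + 1)) := by rw [pow_succ, mul_comm]
  have hbase : q * a 1 ≤ ((T : ℝ) + 1) * a T := by
    have h1 : q ^ (n + 1) * a 1 ≤ a T := (hchain (n + 1)).trans haT
    have h2 : (1 : ℝ) ≤ (2 * q) ^ n := one_le_pow₀ (by linarith)
    have h3 : ((2 : ℝ) ^ n : ℝ) ≤ (T : ℝ) + 1 := by exact_mod_cast (by omega : 2 ^ n ≤ T + 1)
    have h4 : 0 ≤ q ^ (n + 1) * a 1 := by positivity
    calc q * a 1 ≤ q * a 1 * (2 * q) ^ n := le_mul_of_one_le_right (by positivity) h2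
      _ = (2 : ℝ) ^ n * (q ^ (n + 1) * a 1) := by rw [mul_pow]; ring
      _ ≤ ((T : ℝ) + 1) * a T := mul_le_mul h3 h1 h4 (by positivity)
  have haTpos := hpos T
  have hfrac : a 0 = a 0 / (q * a 1) * (q * a 1) := by field_simp
  have hc0 : 0 ≤ a 0 / (q * a 1) := by positivity
  calc ∑ i ∈ range (T + 1), a i = a 0 + ∑ i ∈ Ico 1 (T + 1), a i := hsplit
    _ ≤ a 0 / (q * a 1) * (q * a 1) + D * 2 ^ (n + 1) * a (2 ^ (n + 1)) := by
        rw [← hfrac]; exact add_le_add le_rfl (hsub.trans hdy)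
    _ ≤ a 0 / (q * a 1) * (((T : ℝ) + 1) * a T) + D * (2 * ((T : ℝ) + 1)) * a T := by
        refine add_le_add (mul_le_mul_of_nonneg_left hbase hc0) ?_
        exact mul_le_mul (mul_le_mul_of_nonneg_left h2n hD0.le) haT (hpos _).le (by positivity)
    _ = (2 * D + a 0 / (q * a 1)) * ((T : ℝ) + 1) * a T := by ring

/-- **The window two-point lower bound from DOUBLING regularity of the triangle tail**: if
`q·triDl T ≤ triDl(2T)` for all `T ≥ 1` with some `q > 1/2` (predicted `triDl(2T)/triDl T → 2^(-1/4) ≈ 0.84`), then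
`WTLB`. [cite: KrachunPanagiotis2026, §3; GlazmanManolescu2019, §4.1] -/
theorem windowTwoPointLowerBound_of_doubling {q : ℝ} (hq : 1 / 2 < q)
    (hd : ∀ T : ℕ, 1 ≤ T → q * triDl T ≤ triDl (2 * T)) :
    ∃ θa θb C : ℝ, 0 < θa ∧ θa < θb ∧ θb ≤ 1 / 4 ∧ 0 < C ∧ ∃ R₀ : ℝ, 0 < R₀ ∧ ∀ R : ℝ, R₀ ≤ R → ∀ (x : Literature.Probability.LatticeModels.Site 2) (B : Finset Literature.Probability.LatticeModels.HexVertex) (S' : Finset ℤ), (∀ v : Literature.Probability.LatticeModels.HexVertex, v ∈ B ↔ (x 1 ≤ v.1 1 ∧ dist (Literature.Probability.LatticeModels.hexCenter v) (Literature.Probability.RandomPlanarGeometry.SAW.hexMidpoint s((x - Pi.single 1 1, 1), (x, 0))) ≤ R)) → (∀ d : ℤ, d ∈ S' ↔ (θa * R ≤ (d : ℝ) ∧ (d : ℝ) ≤ θb * R)) → Literature.Probability.RandomPlanarGeometry.SAW.HV.triDl ⌊R / 4⌋₊ ≤ C * ∑ d ∈ S', ∑ γ : Literature.Probability.RandomPlanarGeometry.SAW.HexMidEdgeSAW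 B s((x - Pi.single 1 1, 1), (x, 0)) s((x + Pi.single 0 d - Pi.single 1 1, 1), (x + Pi.single 0 d, 0)), Literature.Probability.RandomPlanarGeometry.SAW.hexCriticalFugacity ^ γ.length :=
  stub_windowTwoPointLowerBound_of_reg
    (reg_of_doubling stub_triDl_pos (fun _ _ h => triDl_antitone h) hq hd)

end Summit.CriticalPhenomena.SAWScalingLimit.Theorems.HexConjecture.RootLocality

end
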